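import Summits.QuantumFields.BalabanUV.Beta.CompositeMixedTable
import Summits.QuantumFields.BalabanUV.Beta.SymAveragingMixedJetTables
import Literature.MathematicalPhysics.QuantumFieldTheory.Balaban1983to89.Beta.SecondOrderResponse

/-!
# `BalabanUV.Beta.CompositeMixedTableBounds` — row D1 ∕ (C1), file F6c part 2 (brick-generic): THE BOUND of the composite mixed third-order kernel
# of `CompositeMixedTable` by induction (`|compMixKer m| ≤ bndMix m`), §2 the (Lmix)-shape locality `LocStencilFM (L^m)` at every rate via a window-generic
# lemma, §3 the ROOTED instantiation's (Lmix) (an1's `mixAbs` bound uniform along the roots), §4 the (0.4)-SYMMETRISED instantiation (bricks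
# `symLinKerAt ∕ symVhKerAt ∕ symHessKerAt ∕ symMixKerAt (toSite r) L` at one root): ANCHORS `compMixKer_sym_one` ∕ **`compMixFF_sym_one = symMixFFAt (toSite r) L`**
# (the record's `mixFF` slot, `SymSecondOrderTablesAn1.symTablesAn1S2_mixFF`, at `toSite r = ctr`), (Tmix) `compMixFF_sym_translate`, (Lmix) `locStencilFM_compMixFF_sym`
# with an1's `symMixAbs` (no uniformity hypothesis: one root), `compMixFF_sym_hmix`.  (There is no «RootedSym» variant of the mixed table: its one background
# slot has nothing to symmetrise — contrast F5c's `vh2KerSymAt`.)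

[folklore] finite sums ∕ one induction ∕ case splits over OUR typed objects + F3b's `abs_compLinKer_le ∕ abs_compVHKer_le` + an1's brick bounds BY NAME; ONE [our object — bookkeeping]
function (`bndMix`).  Nothing of Bałaban's
asserted, valued or discharged; 0 estimates; 0∕4 row-D1 binders; NOT (C1), NOT D1, NEVER «G-an2-4 closed», NOT BetaPertH, NOT continuum, NOT Clay.

HONEST DEPENDENCY (page 1, mandatory): continuum YM on T⁴ ⇐ BetaPertH ∧ nine spine estimates (0/9 proved); BetaPertH ⇐ (D1) ∧
(D4) ∧ CAP+tail; G-an2-4 gates asym, D1 and NE2/3/4.  Row D1 ∕ (C1) OWNER an2, gen 51 ∕ 52 (§4), 2026-08-23 ∕ 24.  No existing file touched.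
-/

noncomputable section

open scoped BigOperators

namespace Summit.QuantumFields.BalabanUV.Beta.CompositeMixedTable

open Finset
open Literature.MathematicalPhysics.QuantumFieldTheory.Balaban1983to89
open Literature.MathematicalPhysics.QuantumFieldTheory.Balaban1983to89.Beta
open AffineAveraging (Site)
open AveragingHessianKernels (Bond)
open Summit.QuantumFields.BalabanUV.Beta.CompositeVertexKernelRec (offs card_offs compLinKer compVHKer bndVH bndVH_nonneg abs_compLinKer_le abs_compVHKer_le)

variable {d : ℕ}
variable {ℓ : ℕ → Fin (d + 1) → Site (d + 1) → Bond (d + 1) → ℝ}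
  {𝓋 𝒽 : ℕ → Fin (d + 1) → Site (d + 1) → Bond (d + 1) → Bond (d + 1) → ℝ}
  {𝓉 : ℕ → Fin (d + 1) → Site (d + 1) → Bond (d + 1) → Bond (d + 1) → Bond (d + 1) → ℝ} {L : ℕ}

/-! ## §1 Bound by induction -/

/-- [our object — bookkeeping] The recursive bound of the composite mixed kernel (`D = (d+1)(2L)^{d+1}`, `Cℓ = D·Bℓ`): `bndMix 0 = 0`,
`bndMix (m+1) = D³·B𝓉·Cℓ^{3m} + 2·D²·B𝒽·bndVH(B𝓋) m·Cℓ^m + D²·B𝓋·bndVH(B𝒽) m·Cℓ^m + D·Bℓ·bndMix m`. -/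
def bndMix (d L : ℕ) (Bℓ B𝓋 B𝒽 B𝓉 : ℝ) : ℕ → ℝ
  | 0 => 0
  | m + 1 =>
      (((d : ℝ) + 1) * (2 * (L : ℝ)) ^ (d + 1)) ^ 3 * B𝓉 * ((((d : ℝ) + 1) * (2 * (L : ℝ)) ^ (d + 1) * Bℓ) ^ m) ^ 3
        + 2 * (((d : ℝ) + 1) * (2 * (L : ℝ)) ^ (d + 1)) ^ 2 * B𝒽 * bndVH d L Bℓ B𝓋 m * (((d : ℝ) + 1) * (2 * (L : ℝ)) ^ (d + 1) * Bℓ) ^ m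
        + (((d : ℝ) + 1) * (2 * (L : ℝ)) ^ (d + 1)) ^ 2 * B𝓋 * bndVH d L Bℓ B𝒽 m * (((d : ℝ) + 1) * (2 * (L : ℝ)) ^ (d + 1) * Bℓ) ^ m
        + ((d : ℝ) + 1) * (2 * (L : ℝ)) ^ (d + 1) * Bℓ * bndMix d L Bℓ B𝓋 B𝒽 B𝓉 m

/-- [folklore] `0 ≤ bndMix`. -/
theorem bndMix_nonneg {Bℓ B𝓋 B𝒽 B𝓉 : ℝ} (hB : 0 ≤ Bℓ) (hB' : 0 ≤ B𝓋) (hB'' : 0 ≤ B𝒽) (hB''' : 0 ≤ B𝓉) : ∀ m, 0 ≤ bndMix d L Bℓ B𝓋 B𝒽 B𝓉 m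
  | 0 => le_rfl
  | m + 1 => by
      have h : 0 ≤ bndMix d L Bℓ B𝓋 B𝒽 B𝓉 m := bndMix_nonneg hB hB' hB'' hB''' m
      have h' : 0 ≤ bndVH d L Bℓ B𝓋 m := bndVH_nonneg hB hB' m
      have h'' : 0 ≤ bndVH d L Bℓ B𝒽 m := bndVH_nonneg hB hB'' m
      show 0 ≤ (((d : ℝ) + 1) * (2 * (L : ℝ)) ^ (d + 1)) ^ 3 * B𝓉 * ((((d : ℝ) + 1) * (2 * (L : ℝ)) ^ (d + 1) * Bℓ) ^ m) ^ 3
        + 2 * (((d : ℝ) + 1) * (2 * (L : ℝ)) ^ (d + 1)) ^ 2 * B𝒽 * bndVH d L Bℓ B𝓋 m * (((d : ℝ) + 1) * (2 * (L : ℝ)) ^ (d + 1) * Bℓ) ^ m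
        + (((d : ℝ) + 1) * (2 * (L : ℝ)) ^ (d + 1)) ^ 2 * B𝓋 * bndVH d L Bℓ B𝒽 m * (((d : ℝ) + 1) * (2 * (L : ℝ)) ^ (d + 1) * Bℓ) ^ m
        + ((d : ℝ) + 1) * (2 * (L : ℝ)) ^ (d + 1) * Bℓ * bndMix d L Bℓ B𝓋 B𝒽 B𝓉 m
      positivity

/-- [folklore] the triangle inequality for five summands. -/
theorem abs_add_five (a b c e g : ℝ) : |a + b + c + e + g| ≤ |a| + |b| + |c| + |e| + |g| := by
  have h1 := abs_add_le (a + b + c + e) g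
  have h2 := abs_add_le (a + b + c) e
  have h3 := abs_add_le (a + b) c
  have h4 := abs_add_le a b
  linarith

/-- [folklore] BOUND ON THE COMPOSITE MIXED KERNEL: `|compMixKer m| ≤ bndMix m`. -/
theorem abs_compMixKer_le {Bℓ B𝓋 B𝒽 B𝓉 : ℝ} (hB : 0 ≤ Bℓ) (hB' : 0 ≤ B𝓋) (hB'' : 0 ≤ B𝒽) (hB''' : 0 ≤ B𝓉)
    (hℓb : ∀ m μ y f, |ℓ m μ y f| ≤ Bℓ) (h𝓋b : ∀ m μ y f f', |𝓋 m μ y f f'| ≤ B𝓋) (h𝒽b : ∀ m μ y f f', |𝒽 m μ y f f'| ≤ B𝒽)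
    (h𝓉b : ∀ m μ y g f f', |𝓉 m μ y g f f'| ≤ B𝓉) :
    ∀ (m : ℕ) (μ : Fin (d + 1)) (y : Site (d + 1)) (g f f' : Bond (d + 1)),
      |compMixKer ℓ 𝓋 𝒽 𝓉 L m μ y g f f'| ≤ bndMix d L Bℓ B𝓋 B𝒽 B𝓉 m
  | 0, _, _, _, _, _ => by rw [compMixKer_zero, abs_zero]; exact le_rfl
  | m + 1, μ, y, g, f, f' => by
      rw [compMixKer_succ]
      set D := ((d : ℝ) + 1) * (2 * (L : ℝ)) ^ (d + 1) with hD
      set C := ((d : ℝ) + 1) * (2 * (L : ℝ)) ^ (d + 1) * Bℓ with hC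
      have hCm : 0 ≤ C ^ m := pow_nonneg (by positivity) m
      have hIH := abs_compMixKer_le hB hB' hB'' hB''' hℓb h𝓋b h𝒽b h𝓉b m
      have hbM := bndMix_nonneg (d := d) (L := L) hB hB' hB'' hB''' m
      have hb1 := bndVH_nonneg (d := d) (L := L) hB hB' m
      have hb2 := bndVH_nonneg (d := d) (L := L) hB hB'' m
      have hKv := abs_compVHKer_le (ℓ := ℓ) (𝓋 := 𝓋) (L := L) hB hB' hℓb h𝓋b m
      have hKh := abs_compVHKer_le (ℓ := ℓ) (𝓋 := 𝒽) (L := L) hB hB'' hℓb h𝒽b m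
      have hL1 := abs_compLinKer_le (ℓ := ℓ) (L := L) hB hℓb m
      have S1 : |∑ κ : Fin (d + 1), ∑ e ∈ offs L, ∑ κ₁ : Fin (d + 1), ∑ e₁ ∈ offs L, ∑ κ₂ : Fin (d + 1), ∑ e₂ ∈ offs L,
          𝓉 m μ y (κ, (L : ℤ) • y + e) (κ₁, (L : ℤ) • y + e₁) (κ₂, (L : ℤ) • y + e₂)
            * compLinKer ℓ L m g (κ, (L : ℤ) • y + e) * compLinKer ℓ L m f (κ₁, (L : ℤ) • y + e₁)
            * compLinKer ℓ L m f' (κ₂, (L : ℤ) • y + e₂)|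
          ≤ D ^ 3 * B𝓉 * (C ^ m) ^ 3 := by
        calc _ ≤ ∑ κ : Fin (d + 1), ∑ e ∈ offs L, ∑ κ₁ : Fin (d + 1), ∑ e₁ ∈ offs L, ∑ κ₂ : Fin (d + 1), ∑ e₂ ∈ offs L,
                B𝓉 * C ^ m * C ^ m * C ^ m := by
              refine (Finset.abs_sum_le_sum_abs _ _).trans (Finset.sum_le_sum fun κ _ => ?_)
              refine (Finset.abs_sum_le_sum_abs _ _).trans (Finset.sum_le_sum fun e _ => ?_)
              refine (Finset.abs_sum_le_sum_abs _ _).trans (Finset.sum_le_sum fun κ₁ _ => ?_)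
              refine (Finset.abs_sum_le_sum_abs _ _).trans (Finset.sum_le_sum fun e₁ _ => ?_)
              refine (Finset.abs_sum_le_sum_abs _ _).trans (Finset.sum_le_sum fun κ₂ _ => ?_)
              refine (Finset.abs_sum_le_sum_abs _ _).trans (Finset.sum_le_sum fun e₂ _ => ?_)
              rw [abs_mul, abs_mul, abs_mul]
              exact mul_le_mul (mul_le_mul (mul_le_mul (h𝓉b _ _ _ _ _ _) (hL1 _ _) (abs_nonneg _) hB''') (hL1 _ _)
                (abs_nonneg _) (mul_nonneg hB''' hCm)) (hL1 _ _) (abs_nonneg _) (mul_nonneg (mul_nonneg hB''' hCm) hCm)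
          _ = D ^ 3 * B𝓉 * (C ^ m) ^ 3 := by
              simp only [Finset.sum_const, Finset.card_univ, Fintype.card_fin, nsmul_eq_mul, card_offs]
              rw [hD]; push_cast; ring
      have S2 : |∑ κ₁ : Fin (d + 1), ∑ e₁ ∈ offs L, ∑ κ₂ : Fin (d + 1), ∑ e₂ ∈ offs L,
          𝒽 m μ y (κ₁, (L : ℤ) • y + e₁) (κ₂, (L : ℤ) • y + e₂)
            * compVHKer ℓ 𝓋 L m κ₁ ((L : ℤ) • y + e₁) f g * compLinKer ℓ L m f' (κ₂, (L : ℤ) • y + e₂)|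
          ≤ D ^ 2 * B𝒽 * bndVH d L Bℓ B𝓋 m * C ^ m := by
        calc _ ≤ ∑ κ₁ : Fin (d + 1), ∑ e₁ ∈ offs L, ∑ κ₂ : Fin (d + 1), ∑ e₂ ∈ offs L, B𝒽 * bndVH d L Bℓ B𝓋 m * C ^ m := by
              refine (Finset.abs_sum_le_sum_abs _ _).trans (Finset.sum_le_sum fun κ₁ _ => ?_)
              refine (Finset.abs_sum_le_sum_abs _ _).trans (Finset.sum_le_sum fun e₁ _ => ?_)
              refine (Finset.abs_sum_le_sum_abs _ _).trans (Finset.sum_le_sum fun κ₂ _ => ?_)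
              refine (Finset.abs_sum_le_sum_abs _ _).trans (Finset.sum_le_sum fun e₂ _ => ?_)
              rw [abs_mul, abs_mul]
              exact mul_le_mul (mul_le_mul (h𝒽b _ _ _ _ _) (hKv _ _ _ _) (abs_nonneg _) hB'') (hL1 _ _) (abs_nonneg _)
                (mul_nonneg hB'' hb1)
          _ = D ^ 2 * B𝒽 * bndVH d L Bℓ B𝓋 m * C ^ m := by
              simp only [Finset.sum_const, Finset.card_univ, Fintype.card_fin, nsmul_eq_mul, card_offs]
              rw [hD]; push_cast; ring
      have S3 : |∑ κ₁ : Fin (d + 1), ∑ e₁ ∈ offs L, ∑ κ₂ : Fin (d + 1), ∑ e₂ ∈ offs L,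
          𝒽 m μ y (κ₁, (L : ℤ) • y + e₁) (κ₂, (L : ℤ) • y + e₂)
            * compLinKer ℓ L m f (κ₁, (L : ℤ) • y + e₁) * compVHKer ℓ 𝓋 L m κ₂ ((L : ℤ) • y + e₂) f' g|
          ≤ D ^ 2 * B𝒽 * bndVH d L Bℓ B𝓋 m * C ^ m := by
        calc _ ≤ ∑ κ₁ : Fin (d + 1), ∑ e₁ ∈ offs L, ∑ κ₂ : Fin (d + 1), ∑ e₂ ∈ offs L, B𝒽 * C ^ m * bndVH d L Bℓ B𝓋 m := by
              refine (Finset.abs_sum_le_sum_abs _ _).trans (Finset.sum_le_sum fun κ₁ _ => ?_)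
              refine (Finset.abs_sum_le_sum_abs _ _).trans (Finset.sum_le_sum fun e₁ _ => ?_)
              refine (Finset.abs_sum_le_sum_abs _ _).trans (Finset.sum_le_sum fun κ₂ _ => ?_)
              refine (Finset.abs_sum_le_sum_abs _ _).trans (Finset.sum_le_sum fun e₂ _ => ?_)
              rw [abs_mul, abs_mul]
              exact mul_le_mul (mul_le_mul (h𝒽b _ _ _ _ _) (hL1 _ _) (abs_nonneg _) hB'') (hKv _ _ _ _) (abs_nonneg _)
                (mul_nonneg hB'' hCm)
          _ = D ^ 2 * B𝒽 * bndVH d L Bℓ B𝓋 m * C ^ m := by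
              simp only [Finset.sum_const, Finset.card_univ, Fintype.card_fin, nsmul_eq_mul, card_offs]
              rw [hD]; push_cast; ring
      have S4 : |∑ κ₁ : Fin (d + 1), ∑ e₁ ∈ offs L, ∑ κ : Fin (d + 1), ∑ e ∈ offs L,
          𝓋 m μ y (κ₁, (L : ℤ) • y + e₁) (κ, (L : ℤ) • y + e)
            * compVHKer ℓ 𝒽 L m κ₁ ((L : ℤ) • y + e₁) f f' * compLinKer ℓ L m g (κ, (L : ℤ) • y + e)|
          ≤ D ^ 2 * B𝓋 * bndVH d L Bℓ B𝒽 m * C ^ m := by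
        calc _ ≤ ∑ κ₁ : Fin (d + 1), ∑ e₁ ∈ offs L, ∑ κ : Fin (d + 1), ∑ e ∈ offs L, B𝓋 * bndVH d L Bℓ B𝒽 m * C ^ m := by
              refine (Finset.abs_sum_le_sum_abs _ _).trans (Finset.sum_le_sum fun κ₁ _ => ?_)
              refine (Finset.abs_sum_le_sum_abs _ _).trans (Finset.sum_le_sum fun e₁ _ => ?_)
              refine (Finset.abs_sum_le_sum_abs _ _).trans (Finset.sum_le_sum fun κ _ => ?_)
              refine (Finset.abs_sum_le_sum_abs _ _).trans (Finset.sum_le_sum fun e _ => ?_)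
              rw [abs_mul, abs_mul]
              exact mul_le_mul (mul_le_mul (h𝓋b _ _ _ _ _) (hKh _ _ _ _) (abs_nonneg _) hB') (hL1 _ _) (abs_nonneg _)
                (mul_nonneg hB' hb2)
          _ = D ^ 2 * B𝓋 * bndVH d L Bℓ B𝒽 m * C ^ m := by
              simp only [Finset.sum_const, Finset.card_univ, Fintype.card_fin, nsmul_eq_mul, card_offs]
              rw [hD]; push_cast; ring
      have S5 : |∑ κ : Fin (d + 1), ∑ e ∈ offs L, ℓ m μ y (κ, (L : ℤ) • y + e) * compMixKer ℓ 𝓋 𝒽 𝓉 L m κ ((L : ℤ) • y + e) g f f'|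
          ≤ D * Bℓ * bndMix d L Bℓ B𝓋 B𝒽 B𝓉 m := by
        calc _ ≤ ∑ κ : Fin (d + 1), ∑ e ∈ offs L, Bℓ * bndMix d L Bℓ B𝓋 B𝒽 B𝓉 m := by
              refine (Finset.abs_sum_le_sum_abs _ _).trans (Finset.sum_le_sum fun κ _ => ?_)
              refine (Finset.abs_sum_le_sum_abs _ _).trans (Finset.sum_le_sum fun e _ => ?_)
              rw [abs_mul]
              exact mul_le_mul (hℓb _ _ _ _) (hIH _ _ _ _ _) (abs_nonneg _) hB
          _ = D * Bℓ * bndMix d L Bℓ B𝓋 B𝒽 B𝓉 m := by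
              simp only [Finset.sum_const, Finset.card_univ, Fintype.card_fin, nsmul_eq_mul, card_offs]
              rw [hD]; push_cast; ring
      refine (abs_add_five _ _ _ _ _).trans ?_
      refine (add_le_add (add_le_add (add_le_add (add_le_add S1 S2) S3) S4) S5).trans (le_of_eq ?_)
      rw [hD, hC]; show _ = _ + _ + _ + _; ring

/-! ## §2 (Lmix): the packed composite mixed table is a local field–multiplier family at blocking `L^m` -/

section Loc

open ExpKernelCalculus (MKer BiLoc)
open OneStepResolventKernel (Fib)
open SecondOrderResponse (LocStencilFM)
open B12Sec2to5 (l1 l1_nonneg)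
open Summit.QuantumFields.BalabanUV.Beta.CompositeVertexKernelRec (winF wid smul_mem_winF l1_le_of_mem_winF)
open Summit.QuantumFields.BalabanUV.Beta.CompositeHessianTable (packFF packFF_inl_inl packFF_inl_inr packFF_inr)

/-- [folklore] **A PACKED FIELD–FIELD FAMILY INDEXED BY A BACKGROUND BOND AND A COARSE BOND, SUPPORTED IN SCALE-`N` WINDOWS OF WIDTH `W` IN ALL THREE FINE
SLOTS, IS A `LocStencilFM N` FAMILY** at every rate `δ ≥ 0`, constant `C · e^{3(d+1)Wδ}` (the background bond `u`, and both field points, lie in the window of `y`, which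
opens at `N·y`; window-generic twin of an1's `mixFFAt_hmix` shape). -/
theorem locStencilFM_packFF_of_window (M : Fin (d + 1) → Site (d + 1) → Fin (d + 1) → Site (d + 1) → Bond (d + 1) → Bond (d + 1) → ℝ)
    {N : ℕ} (W : ℕ) {C : ℝ} (hC : 0 ≤ C)
    (h₀ : ∀ κ u μ y f f', u ∉ winF N W y → M κ u μ y f f' = 0) (h₁ : ∀ κ u μ y f f', f.2 ∉ winF N W y → M κ u μ y f f' = 0)
    (h₂ : ∀ κ u μ y f f', f'.2 ∉ winF N W y → M κ u μ y f f' = 0) (hb : ∀ κ u μ y f f', |M κ u μ y f f'| ≤ C) {δ : ℝ} (hδ : 0 ≤ δ) :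
    LocStencilFM N (fun κ u μ y => packFF (M κ u) μ y) (C * Real.exp (3 * ((d : ℝ) + 1) * W * δ)) δ := by
  intro κ u μ y x x' a b
  dsimp only
  have hpos : 0 ≤ C * Real.exp (3 * ((d : ℝ) + 1) * W * δ) * Real.exp (-δ * l1 (u - (N : ℤ) • y))
      * Real.exp (-δ * (l1 (x - u) + l1 (x' - u))) :=
    mul_nonneg (mul_nonneg (mul_nonneg hC (Real.exp_pos _).le) (Real.exp_pos _).le) (Real.exp_pos _).le
  rcases a with α | ν
  · rcases b with α' | ν'
    · rw [packFF_inl_inl]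
      by_cases hu : u ∈ winF N W y
      · by_cases hx : x ∈ winF N W y
        · by_cases hx' : x' ∈ winF N W y
          · have h0 := smul_mem_winF (N := N) (W := W) y
            have d0 := l1_le_of_mem_winF hu h0
            have d1 := l1_le_of_mem_winF hx hu
            have d2 := l1_le_of_mem_winF hx' hu
            have hW' : (0 : ℝ) ≤ (W : ℝ) := Nat.cast_nonneg W
            have hsum : δ * l1 (u - (N : ℤ) • y) + δ * (l1 (x - u) + l1 (x' - u)) ≤ 3 * ((d : ℝ) + 1) * W * δ := by nlinarith
            have h1 : 1 ≤ Real.exp (3 * ((d : ℝ) + 1) * W * δ) * Real.exp (-δ * l1 (u - (N : ℤ) • y))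
                * Real.exp (-δ * (l1 (x - u) + l1 (x' - u))) := by
              rw [← Real.exp_add, ← Real.exp_add]; exact Real.one_le_exp (by linarith)
            calc |M κ u μ y (α, x) (α', x')| ≤ C * 1 := by rw [mul_one]; exact hb _ _ _ _ _ _
              _ ≤ C * (Real.exp (3 * ((d : ℝ) + 1) * W * δ) * Real.exp (-δ * l1 (u - (N : ℤ) • y))
                  * Real.exp (-δ * (l1 (x - u) + l1 (x' - u)))) := mul_le_mul_of_nonneg_left h1 hC
              _ = _ := by ring
          · rw [h₂ κ u μ y (α, x) (α', x') hx', abs_zero]; exact hpos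
        · rw [h₁ κ u μ y (α, x) (α', x') hx, abs_zero]; exact hpos
      · rw [h₀ κ u μ y (α, x) (α', x') hu, abs_zero]; exact hpos
    · rw [packFF_inl_inr, abs_zero]; exact hpos
  · rw [packFF_inr, abs_zero]; exact hpos

/-- [folklore] **(Lmix)-SHAPE LOCALITY OF THE PACKED COMPOSITE MIXED TABLE AT EVERY RATE**: `LocStencilFM (L^m) (compMixFF … m) (bndMix m · e^{3(d+1)·wid m·δ}) δ`. -/
theorem locStencilFM_compMixFF {Bℓ B𝓋 B𝒽 B𝓉 : ℝ} (hB : 0 ≤ Bℓ) (hB' : 0 ≤ B𝓋) (hB'' : 0 ≤ B𝒽) (hB''' : 0 ≤ B𝓉)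
    (hℓb : ∀ m μ y f, |ℓ m μ y f| ≤ Bℓ) (h𝓋b : ∀ m μ y f f', |𝓋 m μ y f f'| ≤ B𝓋) (h𝒽b : ∀ m μ y f f', |𝒽 m μ y f f'| ≤ B𝒽)
    (h𝓉b : ∀ m μ y g f f', |𝓉 m μ y g f f'| ≤ B𝓉) (m : ℕ) {δ : ℝ} (hδ : 0 ≤ δ) :
    LocStencilFM (L ^ m) (compMixFF ℓ 𝓋 𝒽 𝓉 L m) (bndMix d L Bℓ B𝓋 B𝒽 B𝓉 m * Real.exp (3 * ((d : ℝ) + 1) * (wid L m) * δ)) δ :=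
  locStencilFM_packFF_of_window (fun κ u μ y f f' => compMixKer ℓ 𝓋 𝒽 𝓉 L m μ y (κ, u) f f') (wid L m)
    (bndMix_nonneg hB hB' hB'' hB''' m) (fun _ _ _ _ f f' h => compMixKer_eq_zero_bg m f f' h)
    (fun κ u _ _ _ f' h => compMixKer_eq_zero_left m (κ, u) f' h) (fun κ u _ _ f _ h => compMixKer_eq_zero_right m (κ, u) f h)
    (fun κ u μ y f f' => abs_compMixKer_le hB hB' hB'' hB''' hℓb h𝓋b h𝒽b h𝓉b m μ y (κ, u) f f') hδ

/-- [folklore] **(Lmix) in the record's letter shape** (rate `1`): `∃ C δ, 0 < δ ∧ LocStencilFM (L^m) (compMixFF … m) C δ`. -/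
theorem compMixFF_hmix {Bℓ B𝓋 B𝒽 B𝓉 : ℝ} (hB : 0 ≤ Bℓ) (hB' : 0 ≤ B𝓋) (hB'' : 0 ≤ B𝒽) (hB''' : 0 ≤ B𝓉)
    (hℓb : ∀ m μ y f, |ℓ m μ y f| ≤ Bℓ) (h𝓋b : ∀ m μ y f f', |𝓋 m μ y f f'| ≤ B𝓋) (h𝒽b : ∀ m μ y f f', |𝒽 m μ y f f'| ≤ B𝒽)
    (h𝓉b : ∀ m μ y g f f', |𝓉 m μ y g f f'| ≤ B𝓉) (m : ℕ) :
    ∃ C δ : ℝ, 0 < δ ∧ LocStencilFM (L ^ m) (compMixFF ℓ 𝓋 𝒽 𝓉 L m) C δ :=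
  ⟨_, 1, one_pos, locStencilFM_compMixFF hB hB' hB'' hB''' hℓb h𝓋b h𝒽b h𝓉b m zero_le_one⟩

end Loc

/-! ## §3 The rooted instantiation: bound and (Lmix) -/

section Rooted

open ExpKernelCalculus (MKer BiLoc)
open OneStepResolventKernel (Fib)
open SecondOrderResponse (LocStencilFM)
open AffineAveraging (box toSite)
open AveragingHessianKernels (ell)
open AveragingHessianKernelsRooted (linKerAt vhKerAt hessKerAt)
open AveragingMixedJetTables (mixKerAt mixAbs)
open Summit.QuantumFields.BalabanUV.Beta.CompositeVertexKernelRec (wid)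

variable {r : ℕ → (Fin (d + 1) → ℕ)}

/-- [folklore] (R) (Lmix): the rooted composite mixed table at blocking `L^m` is a `LocStencilFM (L^m)` family at every rate, whenever an1's finite-range bound
`mixAbs (toSite (r m)) L` is uniformly `≤ B𝓉` along the tower's roots. -/
theorem locStencilFM_compMixFF_rooted (hL : 1 ≤ L) (hr : ∀ k, r k ∈ box (d + 1) L) {B𝓉 : ℝ} (hB𝓉 : 0 ≤ B𝓉)
    (hB𝓉b : ∀ m, mixAbs (toSite (r m)) L ≤ B𝓉) (m : ℕ) {δ : ℝ} (hδ : 0 ≤ δ) :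
    LocStencilFM (L ^ m)
      (compMixFF (fun m => linKerAt (toSite (r m)) L) (fun m => vhKerAt (toSite (r m)) L) (fun m => hessKerAt (toSite (r m)) L)
        (fun m => mixKerAt (toSite (r m)) L) L m)
      (bndMix d L (ell (d + 1) L : ℝ) (3 * (ell (d + 1) L : ℝ) ^ 2) (2 * (ell (d + 1) L : ℝ) ^ 2) B𝓉 m * Real.exp (3 * ((d : ℝ) + 1) * (wid L m) * δ)) δ :=
  locStencilFM_compMixFF (ℓ := fun m => linKerAt (toSite (r m)) L) (𝓋 := fun m => vhKerAt (toSite (r m)) L)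
    (𝒽 := fun m => hessKerAt (toSite (r m)) L) (𝓉 := fun m => mixKerAt (toSite (r m)) L)
    (by positivity) (by positivity) (by positivity) hB𝓉
    (fun m μ y f => AveragingHessianKernelsRooted.abs_linKerAt_le hL μ y (hr m) f)
    (fun m μ y f f' => AveragingHessianKernelsRooted.abs_vhKerAt_le hL μ y (hr m) f f')
    (fun m μ y f f' => AveragingHessianKernelsRooted.abs_hessKerAt_le hL μ y (hr m) f f')
    (fun m μ y g f f' => (AveragingMixedJetTables.abs_tTab_le (hr m) μ y f f' g).trans (hB𝓉b m)) m hδ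

/-- [folklore] (R) (Lmix) in the record's letter shape (rate `1`). -/
theorem compMixFF_rooted_hmix (hL : 1 ≤ L) (hr : ∀ k, r k ∈ box (d + 1) L) {B𝓉 : ℝ} (hB𝓉 : 0 ≤ B𝓉)
    (hB𝓉b : ∀ m, mixAbs (toSite (r m)) L ≤ B𝓉) (m : ℕ) :
    ∃ C δ : ℝ, 0 < δ ∧ LocStencilFM (L ^ m)
      (compMixFF (fun m => linKerAt (toSite (r m)) L) (fun m => vhKerAt (toSite (r m)) L) (fun m => hessKerAt (toSite (r m)) L)
        (fun m => mixKerAt (toSite (r m)) L) L m) C δ :=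
  ⟨_, 1, one_pos, locStencilFM_compMixFF_rooted hL hr hB𝓉 hB𝓉b m zero_le_one⟩

end Rooted

/-! ## §4 The (0.4)-symmetrised instantiation: anchors, (Tmix), bound and (Lmix) -/

section Sym

open ExpKernelCalculus (MKer BiLoc shiftK)
open OneStepResolventKernel (Fib)
open SecondOrderResponse (LocStencilFM)
open AffineAveraging (box toSite)
open AveragingHessianKernels (ell)
open Summit.QuantumFields.BalabanUV.Beta.SymAveragingHessianCounts (symLinKerAt symVhKerAt symHessKerAt)
open Summit.QuantumFields.BalabanUV.Beta.SymAveragingMixedJetTables (symTTab symMixKerAt symMixFFAt symMixAbs symMixAbs_nonneg)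
open Summit.QuantumFields.BalabanUV.Beta.CompositeVertexKernelRec (wid)

variable {r : Fin (d + 1) → ℕ}

/-- [folklore] (S) ANCHOR: over an1's (0.4)-SYMMETRISED bricks (`symMixKerAt` as the third-order one) the depth-one composite mixed kernel IS
`symMixKerAt (toSite r) L` (the brick's three support letters `symTTab_eq_zero₁ ∕ ₂ ∕ ₃` off the window). -/
theorem compMixKer_sym_one (hr : r ∈ box (d + 1) L) (μ : Fin (d + 1)) (y : Site (d + 1)) (g f f' : Bond (d + 1)) :
    compMixKer (fun _ => symLinKerAt (toSite r) L) (fun _ => symVhKerAt (toSite r) L) (fun _ => symHessKerAt (toSite r) L)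
        (fun _ => symMixKerAt (toSite r) L) L 1 μ y g f f'
      = symMixKerAt (toSite r) L μ y g f f' := by
  refine compMixKer_one (fun m μ y g f f' h => ?_) (fun m μ y g f f' h => ?_) (fun m μ y g f f' h => ?_) μ y g f f'
  · show ((symTTab (toSite r) L μ y f f' g : ℚ) : ℝ) = 0
    rw [SymAveragingMixedJetTables.symTTab_eq_zero₃ hr μ y f f' h, Rat.cast_zero]
  · show ((symTTab (toSite r) L μ y f f' g : ℚ) : ℝ) = 0
    rw [SymAveragingMixedJetTables.symTTab_eq_zero₁ hr μ y h f' g, Rat.cast_zero]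
  · show ((symTTab (toSite r) L μ y f f' g : ℚ) : ℝ) = 0
    rw [SymAveragingMixedJetTables.symTTab_eq_zero₂ hr μ y f h g, Rat.cast_zero]

/-- [folklore] (S) ANCHOR AT THE TABLE LEVEL: the depth-one packed composite mixed table over the sym bricks IS an1's `symMixFFAt (toSite r) L` — the `mixFF`
slot of the (0.4) record (`symTablesAn1S2_mixFF`, at the centred root). -/
theorem compMixFF_sym_one (hr : r ∈ box (d + 1) L) :
    compMixFF (fun _ => symLinKerAt (toSite r) L) (fun _ => symVhKerAt (toSite r) L) (fun _ => symHessKerAt (toSite r) L)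
        (fun _ => symMixKerAt (toSite r) L) L 1
      = symMixFFAt (toSite r) L := by
  funext κ u μ y x x' a b
  rcases a with α | ν
  · rcases b with α' | ν'
    · rw [compMixFF_inl_inl, SymAveragingMixedJetTables.symMixFFAt_inl_inl]
      exact compMixKer_sym_one hr μ y (κ, u) (α, x) (α', x')
    · rfl
  · cases b <;> rfl

/-- [folklore] (S) (Tmix): block-translation covariance of the symmetrised composite mixed table at blocking `L^m` (an1's `symMixFFAt_translate` ∕
`symMixFFAt_hmixt` byte shape one composite up). -/
theorem compMixFF_sym_translate (m : ℕ) (κ : Fin (d + 1)) (u : Site (d + 1)) (μ : Fin (d + 1)) (y t : Site (d + 1)) :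
    compMixFF (fun _ => symLinKerAt (toSite r) L) (fun _ => symVhKerAt (toSite r) L) (fun _ => symHessKerAt (toSite r) L)
        (fun _ => symMixKerAt (toSite r) L) L m κ (u + ((L ^ m : ℕ) : ℤ) • t) μ (y + t)
      = shiftK (-(((L ^ m : ℕ) : ℤ) • t))
          (compMixFF (fun _ => symLinKerAt (toSite r) L) (fun _ => symVhKerAt (toSite r) L) (fun _ => symHessKerAt (toSite r) L)
            (fun _ => symMixKerAt (toSite r) L) L m κ u μ y) :=
  compMixFF_translate (ℓ := fun _ => symLinKerAt (toSite r) L) (𝓋 := fun _ => symVhKerAt (toSite r) L)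
    (𝒽 := fun _ => symHessKerAt (toSite r) L) (𝓉 := fun _ => symMixKerAt (toSite r) L)
    (fun _ μ y t f => SymAveragingHessianCounts.symLinKerAt_add (toSite r) L μ y t f)
    (fun _ μ y t f f' => SymAveragingHessianCounts.symVhKerAt_add (toSite r) L μ y t f f')
    (fun _ μ y t f f' => SymAveragingHessianCounts.symHessKerAt_add (toSite r) L μ y t f f')
    (fun _ μ y t g f f' => SymAveragingMixedJetTables.symMixKerAt_add (toSite r) L μ y t g f f') m κ u μ y t

/-- [folklore] (S) BOUND: `|compMixKer (sym bricks) m| ≤ bndMix m` with an1's brick constants `ℓ`, `3ℓ²`, `2ℓ²` and `symMixAbs (toSite r) L` (one root — no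
uniformity hypothesis, contrast §3). -/
theorem abs_compMixKer_sym_le (hL : 1 ≤ L) (hr : r ∈ box (d + 1) L) (m : ℕ) (μ : Fin (d + 1)) (y : Site (d + 1)) (g f f' : Bond (d + 1)) :
    |compMixKer (fun _ => symLinKerAt (toSite r) L) (fun _ => symVhKerAt (toSite r) L) (fun _ => symHessKerAt (toSite r) L)
        (fun _ => symMixKerAt (toSite r) L) L m μ y g f f'|
      ≤ bndMix d L (ell (d + 1) L : ℝ) (3 * (ell (d + 1) L : ℝ) ^ 2) (2 * (ell (d + 1) L : ℝ) ^ 2) (symMixAbs (toSite r) L) m :=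
  abs_compMixKer_le (ℓ := fun _ => symLinKerAt (toSite r) L) (𝓋 := fun _ => symVhKerAt (toSite r) L)
    (𝒽 := fun _ => symHessKerAt (toSite r) L) (𝓉 := fun _ => symMixKerAt (toSite r) L)
    (by positivity) (by positivity) (by positivity) (symMixAbs_nonneg _ _)
    (fun _ μ y f => SymAveragingHessianCounts.abs_symLinKerAt_le hL μ y hr f)
    (fun _ μ y f f' => SymAveragingHessianCounts.abs_symVhKerAt_le hL μ y hr f f')
    (fun _ μ y f f' => SymAveragingHessianCounts.abs_symHessKerAt_le hL μ y hr f f')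
    (fun _ μ y g f f' => SymAveragingMixedJetTables.abs_symTTab_le hr μ y f f' g) m μ y g f f'

/-- [folklore] (S) (Lmix): the symmetrised composite mixed table at blocking `L^m` is a `LocStencilFM (L^m)` family at every rate `δ ≥ 0`, constant
`bndMix m · e^{3(d+1)·wid m·δ}` with an1's `symMixAbs (toSite r) L` as the third-order brick bound. -/
theorem locStencilFM_compMixFF_sym (hL : 1 ≤ L) (hr : r ∈ box (d + 1) L) (m : ℕ) {δ : ℝ} (hδ : 0 ≤ δ) :
    LocStencilFM (L ^ m)
      (compMixFF (fun _ => symLinKerAt (toSite r) L) (fun _ => symVhKerAt (toSite r) L) (fun _ => symHessKerAt (toSite r) L)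
        (fun _ => symMixKerAt (toSite r) L) L m)
      (bndMix d L (ell (d + 1) L : ℝ) (3 * (ell (d + 1) L : ℝ) ^ 2) (2 * (ell (d + 1) L : ℝ) ^ 2) (symMixAbs (toSite r) L) m
        * Real.exp (3 * ((d : ℝ) + 1) * (wid L m) * δ)) δ :=
  locStencilFM_compMixFF (ℓ := fun _ => symLinKerAt (toSite r) L) (𝓋 := fun _ => symVhKerAt (toSite r) L)
    (𝒽 := fun _ => symHessKerAt (toSite r) L) (𝓉 := fun _ => symMixKerAt (toSite r) L)
    (by positivity) (by positivity) (by positivity) (symMixAbs_nonneg _ _)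
    (fun _ μ y f => SymAveragingHessianCounts.abs_symLinKerAt_le hL μ y hr f)
    (fun _ μ y f f' => SymAveragingHessianCounts.abs_symVhKerAt_le hL μ y hr f f')
    (fun _ μ y f f' => SymAveragingHessianCounts.abs_symHessKerAt_le hL μ y hr f f')
    (fun _ μ y g f f' => SymAveragingMixedJetTables.abs_symTTab_le hr μ y f f' g) m hδ

/-- [folklore] (S) (Lmix) in the record's letter shape (rate `1`; an1's `symMixFFAt_hmix` one composite up). -/
theorem compMixFF_sym_hmix (hL : 1 ≤ L) (hr : r ∈ box (d + 1) L) (m : ℕ) :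
    ∃ C δ : ℝ, 0 < δ ∧ LocStencilFM (L ^ m)
      (compMixFF (fun _ => symLinKerAt (toSite r) L) (fun _ => symVhKerAt (toSite r) L) (fun _ => symHessKerAt (toSite r) L)
        (fun _ => symMixKerAt (toSite r) L) L m) C δ :=
  ⟨_, 1, one_pos, locStencilFM_compMixFF_sym hL hr m zero_le_one⟩

end Sym

end Summit.QuantumFields.BalabanUV.Beta.CompositeMixedTable

end
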